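import Summits.CriticalPhenomena.PercolationContinuityZ3.Theorems.PercNearOneGluingNoHeavyQuantShapeHubLaws
import HarnessLib

/-!
# QUANT lane R8, T-DEC: ELEMENTARY-SYMMETRIC MASS BOUND for the sub-floor hub of shape `(lo, K)` — the route bound for LONG TAILS
# (census-1 gen 31)

builds on p205010 (kernel theorem, internal audit signed; external expert review pending)

Support file (`--supports stmt-CriticalPhenomena-4575`), QUANT lane seat prim-quant-census-1 (gen 31); memo
`run/shared/lean/prim/quant/prim-quant-census-1/g31/HUB-GENERAL-G31.md` §0 (7).  One definition (`esL`), theorems with standard axioms, no sorries.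

WHY.  The near-route certificate of `…QuantShapeHubGeneral` (`sdec_sHub`, shapes `lo < K ≤ 3lo/2`) draws its capacity from LIKELIHOOD-RATIO
dominance with the MINIMAL odds `o = min γᵢ/(1−γᵢ)` (`sHub_struct`).  For longer tails (`K > 3lo/2`) the minimal odds can be `< 1` and the bound
`u_{s+r} ≥ o^r·C(j,s+r)/C(j,s)·u_s` is far too weak (memo §0 (7): it fails on hundreds of (hub, gate) instances per width although the hubs are SDEC),
whereas the bound below loses NOTHING numerically against the true masses (code/exp12.py: identical verdicts on every instance).

THE BOUND.  The hub masses are Poisson-binomial: `u_t = Π(1−γᵢ)·e_t(o)`, `e_t` the elementary symmetric polynomial of the odds `oᵢ = γᵢ/(1−γᵢ)`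
(`sHub_mass_esL`).  For odds listed in increasing order `O` (length `j = n + s`):
  **`e_s(O)·e_r(O.take n) ≤ C(s+r, s)·e_{s+r}(O)`**  (`esL_choose_bound`)
— every `s`-subset term of `e_s` extends by `r` odds of its complement, whose `e_r` is at least that of the `n = j−s` SMALLEST odds, and each
`(s+r)`-set is counted `C(s+r,s)` times.  The proof is a division-free induction on the sorted list (head = minimum `a`): Pascal's rule splits
`C(s+r,s)`, the three smaller instances `(s,r)`, `(s,r−1)`, `(s−1,r)` of the claim for the tail are used, and the only inequality is
`e_r(N ++ [b]) = e_r(N) + b·e_{r−1}(N) ≥ e_r(N) + a·e_{r−1}(N)` for `b ≥ a` (`esL_append_single`).  Consequence (`sHub_routeBoundES`):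
  **`u(lo·j + K·s)·e_r((sorted odds).take (j−s)) ≤ C(s+r,s)·u(lo·j + K·(s+r))`** for every list of gates `γᵢ ∈ [0,1)`.
`esL` is permutation invariant (`esL_perm`), so any sorted permutation of the odds may be supplied.

HONEST STATUS.  A tool for the long-tail programme (memo §3 item 2); no census row changes.  `SiblingStep`, `GluedDominated'`, `SDECConvClosed`,
`FarTreeRow` OPEN; RATE class (log\*) / honest sentence of `run/shared/lean/prim/quant/README.md` unchanged.  [this work].  Nothing here is cited
as a published result.  The gluing rows served [cite: KozmaNitzan2024, Conjecture 3 (p. 15)]; product measure [cite: Grimmett1999, §1.3 p. 10].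
-/

noncomputable section

open scoped BigOperators

namespace Summit.CriticalPhenomena.PercolationContinuityZ3.Theorems
namespace Quant
namespace LawDec

open Finset

/-! ### Elementary symmetric polynomials of a list, by the Pascal recursion -/

/-- **elementary symmetric polynomial `e_k` of a list of reals**: `e_0 = 1`, `e_{k+1}([]) = 0`, `e_{k+1}(a :: L) = e_{k+1}(L) + a·e_k(L)`.
[this work] -/
def esL : List ℝ → ℕ → ℝ
  | [], 0 => 1
  | [], _ + 1 => 0
  | _ :: _, 0 => 1
  | a :: L, k + 1 => esL L (k + 1) + a * esL L k

/-- `e_0 = 1`. [this work] -/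
@[simp] theorem esL_zero : ∀ L : List ℝ, esL L 0 = 1
  | [] => rfl
  | _ :: _ => rfl

/-- `e_{k+1}([]) = 0`. [this work] -/
@[simp] theorem esL_nil_succ (k : ℕ) : esL [] (k + 1) = 0 := rfl

/-- the Pascal recursion `e_{k+1}(a :: L) = e_{k+1}(L) + a·e_k(L)`. [this work] -/
@[simp] theorem esL_cons_succ (a : ℝ) (L : List ℝ) (k : ℕ) : esL (a :: L) (k + 1) = esL L (k + 1) + a * esL L k := rfl

/-- `e_k ≥ 0` for nonnegative entries. [this work] -/
theorem esL_nonneg : ∀ (L : List ℝ), (∀ a ∈ L, 0 ≤ a) → ∀ k, 0 ≤ esL L k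
  | [], _, 0 => by simp
  | [], _, _ + 1 => by simp
  | _ :: _, _, 0 => by simp
  | a :: L, hL, k + 1 => by
    have ha : 0 ≤ a := hL a (by simp)
    have hL' : ∀ b ∈ L, 0 ≤ b := fun b hb => hL b (List.mem_cons_of_mem a hb)
    rw [esL_cons_succ]
    exact add_nonneg (esL_nonneg L hL' (k + 1)) (mul_nonneg ha (esL_nonneg L hL' k))

/-- `e_k` vanishes beyond the length. [this work] -/
theorem esL_eq_zero_of_length_lt : ∀ (L : List ℝ) (k : ℕ), L.length < k → esL L k = 0
  | [], 0, h => by simp at h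
  | [], _ + 1, _ => by simp
  | _ :: _, 0, h => by simp at h
  | a :: L, k + 1, h => by
    have h1 : L.length < k + 1 := by simp at h; omega
    have h2 : L.length < k := by simp at h; omega
    rw [esL_cons_succ, esL_eq_zero_of_length_lt L (k + 1) h1, esL_eq_zero_of_length_lt L k h2]; ring

/-- **`e_k` is a symmetric function of the list** (invariant under permutations). [this work] -/
theorem esL_perm {L₁ L₂ : List ℝ} (h : L₁.Perm L₂) : ∀ k, esL L₁ k = esL L₂ k := by
  induction h with
  | nil => intro k; rfl
  | cons a _ ih =>
    intro k
    cases k with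
    | zero => simp
    | succ k => rw [esL_cons_succ, esL_cons_succ, ih (k + 1), ih k]
  | swap a b L =>
    intro k
    cases k with
    | zero => simp
    | succ k =>
      cases k with
      | zero => simp only [esL_cons_succ, esL_zero]; ring
      | succ k => simp only [esL_cons_succ]; ring
  | trans _ _ ih₁ ih₂ => intro k; rw [ih₁ k, ih₂ k]

/-- appending one entry: `e_{k+1}(M ++ [b]) = e_{k+1}(M) + b·e_k(M)`. [this work] -/
theorem esL_append_single (b : ℝ) : ∀ (M : List ℝ) (k : ℕ), esL (M ++ [b]) (k + 1) = esL M (k + 1) + b * esL M k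
  | [], k => by
    cases k with
    | zero => simp [esL]
    | succ k => simp [esL]
  | c :: M, k => by
    rw [List.cons_append, esL_cons_succ, esL_cons_succ, esL_append_single b M k]
    cases k with
    | zero => simp only [esL_zero, mul_one]; ring
    | succ k => rw [esL_append_single b M k, esL_cons_succ]; ring

/-- one more of the entries, all of which are `≥ a ≥ 0`... : `e_{r+1}(L.take (m+1)) ≥ e_{r+1}(L.take m) + a·e_r(L.take m)` for `m < |L|`,
when every entry of `L` is `≥ a` and `≥ 0`. [this work] -/
theorem esL_take_succ_ge (a : ℝ) (L : List ℝ) (hLa : ∀ x ∈ L, a ≤ x) (hL0 : ∀ x ∈ L, 0 ≤ x) (m : ℕ) (hm : m < L.length) (r : ℕ) :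
    esL (L.take m) (r + 1) + a * esL (L.take m) r ≤ esL (L.take (m + 1)) (r + 1) := by
  rw [← List.take_concat_get' L m hm, esL_append_single]
  have hb : a ≤ L[m] := hLa _ (List.getElem_mem hm)
  have h0 : 0 ≤ esL (L.take m) r := esL_nonneg _ (fun x hx => hL0 x (List.mem_of_mem_take hx)) r
  nlinarith

/-- **the elementary-symmetric bound**: for a list `L` of nonnegative reals in INCREASING order and `|L| = n + s`,
`e_s(L)·e_r(L.take n) ≤ C(s+r, s)·e_{s+r}(L)` (the `n` smallest entries bound the extensions of every `s`-subset). [this work] -/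
theorem esL_choose_bound : ∀ (L : List ℝ), L.Pairwise (· ≤ ·) → (∀ x ∈ L, 0 ≤ x) →
    ∀ s r n : ℕ, L.length = n + s → esL L s * esL (L.take n) r ≤ ((s + r).choose s : ℝ) * esL L (s + r)
  | [], _, _, s, r, n, hlen => by
    have hs : s = 0 := by simp at hlen; omega
    subst hs; simp
  | a :: L, hsort, hpos, s, r, n, hlen => by
    rw [List.pairwise_cons] at hsort
    obtain ⟨haL, hsort'⟩ := hsort
    have ha0 : 0 ≤ a := hpos a (by simp)
    have hpos' : ∀ x ∈ L, 0 ≤ x := fun x hx => hpos x (List.mem_cons_of_mem a hx)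
    cases s with
    | zero =>
      have hn : (a :: L).length ≤ n := by omega
      rw [List.take_of_length_le hn]; simp
    | succ s =>
      cases r with
      | zero => simp
      | succ r =>
        cases n with
        | zero =>
          rw [List.take_zero, esL_nil_succ, mul_zero]
          exact mul_nonneg (Nat.cast_nonneg _) (esL_nonneg _ hpos _)
        | succ n =>
          have hlen' : L.length = n + (s + 1) := by simp at hlen; omega
          have hlen'' : L.length = (n + 1) + s := by omega
          -- the three smaller instances for the tail
          have IH1 := esL_choose_bound L hsort' hpos' (s + 1) (r + 1) n hlen'
          have IH2 := esL_choose_bound L hsort' hpos' (s + 1) r n hlen'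
          have IH3 := esL_choose_bound L hsort' hpos' s (r + 1) (n + 1) hlen''
          have T := esL_take_succ_ge a L haL hpos' n (by omega) r
          -- unfold the head
          have e1 : esL (a :: L) (s + 1) = esL L (s + 1) + a * esL L s := esL_cons_succ a L s
          have e2 : (a :: L).take (n + 1) = a :: L.take n := rfl
          have e3 : esL (a :: L.take n) (r + 1) = esL (L.take n) (r + 1) + a * esL (L.take n) r := esL_cons_succ a _ r
          have e4 : esL (a :: L) (s + 1 + (r + 1)) = esL L (s + r + 2) + a * esL L (s + r + 1) := by
            rw [show s + 1 + (r + 1) = (s + r + 1) + 1 by ring, esL_cons_succ]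
          have pascal : ((s + 1 + (r + 1)).choose (s + 1) : ℝ) = ((s + r + 1).choose s : ℝ) + ((s + r + 1).choose (s + 1) : ℝ) := by
            rw [show s + 1 + (r + 1) = (s + r + 1) + 1 by ring, Nat.choose_succ_succ]; push_cast; ring
          rw [e1, e2, e3, e4, pascal]
          have c1 : ((s + 1 + (r + 1)).choose (s + 1) : ℝ) = ((s + r + 1).choose s : ℝ) + ((s + r + 1).choose (s + 1) : ℝ) := pascal
          rw [show s + 1 + (r + 1) = s + r + 2 by ring] at IH1 c1
          rw [show s + 1 + r = s + r + 1 by ring] at IH2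
          rw [show s + (r + 1) = s + r + 1 by ring] at IH3
          rw [c1] at IH1
          have hEs : 0 ≤ esL L s := esL_nonneg L hpos' s
          have hEs1 : 0 ≤ esL L (s + 1) := esL_nonneg L hpos' (s + 1)
          have hF : 0 ≤ esL (L.take n) r := esL_nonneg _ (fun x hx => hpos' x (List.mem_of_mem_take hx)) r
          have hF1 : 0 ≤ esL (L.take n) (r + 1) := esL_nonneg _ (fun x hx => hpos' x (List.mem_of_mem_take hx)) (r + 1)
          -- IH3 combined with T
          have h3 : esL L s * (esL (L.take n) (r + 1) + a * esL (L.take n) r) ≤ ((s + r + 1).choose s : ℝ) * esL L (s + r + 1) :=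
            le_trans (mul_le_mul_of_nonneg_left T hEs) IH3
          have h2a : a * (esL L (s + 1) * esL (L.take n) r) ≤ a * (((s + r + 1).choose (s + 1) : ℝ) * esL L (s + r + 1)) :=
            mul_le_mul_of_nonneg_left IH2 ha0
          have h3a : a * (esL L s * (esL (L.take n) (r + 1) + a * esL (L.take n) r))
              ≤ a * (((s + r + 1).choose s : ℝ) * esL L (s + r + 1)) := mul_le_mul_of_nonneg_left h3 ha0
          nlinarith [IH1, h2a, h3a]

/-! ### The hub masses are `Π(1−γᵢ)·e_t(odds)` -/

/-- mixing a Bernoulli factor in odds form: `(1−γ)AB + γAC = (1−γ)A·(B + γ/(1−γ)·C)`. [this work] -/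
theorem mix_odds (γ A B C : ℝ) (h : 1 - γ ≠ 0) :
    (1 - γ) * (A * B) + γ * (A * C) = (1 - γ) * A * (B + γ / (1 - γ) * C) := by
  have eo : (1 - γ) * (γ / (1 - γ)) = γ := by field_simp
  calc (1 - γ) * (A * B) + γ * (A * C)
      = (1 - γ) * (A * B) + ((1 - γ) * (γ / (1 - γ))) * (A * C) := by rw [eo]
    _ = (1 - γ) * A * (B + γ / (1 - γ) * C) := by ring


/-- **Poisson-binomial masses of the hub of shape `(lo, K)`** (`lo < K`, gates `γᵢ ∈ [0,1)`):
`u(lo·|P| + K·t) = Π(1−γᵢ) · e_t(γ₁/(1−γ₁), …, γ_j/(1−γ_j))`. [this work] -/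
theorem sHub_mass_esL (lo K : ℕ) (hloK : lo < K) : ∀ P : List ℝ, (∀ γ ∈ P, 0 ≤ γ ∧ γ < 1) → ∀ t : ℕ,
    sHub lo K P (lo * P.length + K * t) = (P.map (fun γ => 1 - γ)).prod * esL (P.map (fun γ => γ / (1 - γ))) t
  | [], _, t => by
    have hdef : sHub lo K [] = (fun k : ℕ => if k = (0 : ℕ) then (1 : ℝ) else 0) := rfl
    have hK : 0 < K := lt_of_le_of_lt (Nat.zero_le lo) hloK
    cases t with
    | zero => simp [hdef]
    | succ t =>
      rw [hdef]
      have hne : lo * ([] : List ℝ).length + K * (t + 1) ≠ 0 := by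
        simp only [List.length_nil, mul_zero, zero_add]; positivity
      simp only [if_neg hne, List.map_nil, List.prod_nil, esL_nil_succ, mul_zero]
  | γ :: P, hP, t => by
    have hγ := hP γ (by simp)
    have hP' : ∀ γ' ∈ P, 0 ≤ γ' ∧ γ' < 1 := fun γ' h' => hP γ' (List.mem_cons_of_mem γ h')
    have hP1 : ∀ γ' ∈ P, 0 ≤ γ' ∧ γ' ≤ 1 := fun γ' h' => ⟨(hP' γ' h').1, (hP' γ' h').2.le⟩
    obtain ⟨_, aM, _, _⟩ := sHub_laws lo K P hP1
    obtain ⟨hsupp, _⟩ := sHub_struct lo K hloK 0 le_rfl P (fun γ' h' => ⟨(hP1 γ' h').1, (hP1 γ' h').2, by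
      rw [zero_mul]; exact (hP1 γ' h').1⟩)
    set j : ℕ := P.length with hj
    set μ : ℕ → ℝ := sHub lo K P with hμ
    have hdef : sHub lo K (γ :: P) = lconv ((lo + K) * j) (lo + K) μ
        (fun h : ℕ => (1 - (γ : ℝ)) * (if h = (lo : ℕ) then (1 : ℝ) else 0) +
          (γ : ℝ) * (if h = (lo : ℕ) + (K : ℕ) then (1 : ℝ) else 0)) := rfl
    have happ : ∀ h, sHub lo K (γ :: P) h
        = (1 - γ) * (if lo ≤ h then μ (h - lo) else 0) + γ * (if lo + K ≤ h then μ (h - (lo + K)) else 0) :=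
      fun h => by rw [hdef]; exact lconv_sp_apply lo K ((lo + K) * j) μ γ aM h
    have hlen : (γ :: P).length = j + 1 := by simp [hj]
    have IH := sHub_mass_esL lo K hloK P hP'
    have h1γ : (1 - γ) ≠ 0 := by linarith [hγ.2]
    rw [hlen, happ, List.map_cons, List.prod_cons, List.map_cons]
    have eA : (if lo ≤ lo * (j + 1) + K * t then μ (lo * (j + 1) + K * t - lo) else 0) = μ (lo * j + K * t) := by
      rw [if_pos (by nlinarith [Nat.zero_le (lo * j), Nat.zero_le (K * t)])]
      congr 1; rw [Nat.mul_succ]; omega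
    rw [eA]
    cases t with
    | zero =>
      -- the second term vanishes: `lo·j − K` is not an atom
      have eB : (if lo + K ≤ lo * (j + 1) + K * 0 then μ (lo * (j + 1) + K * 0 - (lo + K)) else 0) = 0 := by
        split_ifs with hc
        · by_contra hne
          obtain ⟨s, hs, _⟩ := hsupp _ hne
          rw [Nat.mul_succ, mul_zero, add_zero] at hs hc
          have hK : 0 < K := lt_of_le_of_lt (Nat.zero_le lo) hloK
          have : lo * j + lo - (lo + K) < lo * j := by omega
          rw [hs] at this
          have : K * s < 0 + 1 := by omega
          have hs0 : s = 0 := by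
            rcases Nat.eq_zero_or_pos s with h0 | h0
            · exact h0
            · exfalso; have := Nat.mul_le_mul_left K h0; omega
          subst hs0
          omega
        · rfl
      have IH0 : μ (lo * j + K * 0) = (P.map (fun γ => 1 - γ)).prod := by
        rw [hμ, hj, IH 0, esL_zero, mul_one]
      rw [eB, IH0, esL_zero]; ring
    | succ t =>
      have eB : (if lo + K ≤ lo * (j + 1) + K * (t + 1) then μ (lo * (j + 1) + K * (t + 1) - (lo + K)) else 0)
          = μ (lo * j + K * t) := by
        rw [if_pos (by nlinarith [Nat.zero_le (lo * j), Nat.zero_le (K * t)])]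
        congr 1
        have : lo * (j + 1) + K * (t + 1) = (lo * j + K * t) + (lo + K) := by ring
        omega
      have IHa : μ (lo * j + K * (t + 1)) = (P.map (fun γ => 1 - γ)).prod * esL (P.map (fun γ => γ / (1 - γ))) (t + 1) := by
        rw [hμ, hj]; exact IH (t + 1)
      have IHb : μ (lo * j + K * t) = (P.map (fun γ => 1 - γ)).prod * esL (P.map (fun γ => γ / (1 - γ))) t := by
        rw [hμ, hj]; exact IH t
      rw [eB, IHa, IHb, esL_cons_succ]
      exact mix_odds γ _ _ _ h1γ

/-- **the elementary-symmetric ROUTE BOUND for the hub of shape `(lo, K)`** (`lo < K`; gates `γᵢ ∈ [0,1)`; `O` any increasing arrangement of the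
odds `γᵢ/(1−γᵢ)`; `s ≤ j = |P|`): `u(lo·j + K·s) · e_r(O.take (j − s)) ≤ C(s+r, s) · u(lo·j + K·(s+r))` — the `j − s` smallest odds drive the
mass `r` steps up the progression.  (For long tails `K > 3lo/2` this replaces the min-odds likelihood-ratio bound of `sHub_struct`.) [this work] -/
theorem sHub_routeBoundES (lo K : ℕ) (hloK : lo < K) (P : List ℝ) (hP : ∀ γ ∈ P, 0 ≤ γ ∧ γ < 1)
    (O : List ℝ) (hO : O.Perm (P.map (fun γ => γ / (1 - γ)))) (hOs : O.Pairwise (· ≤ ·))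
    (s r : ℕ) (hs : s ≤ P.length) :
    sHub lo K P (lo * P.length + K * s) * esL (O.take (P.length - s)) r
      ≤ ((s + r).choose s : ℝ) * sHub lo K P (lo * P.length + K * (s + r)) := by
  rw [sHub_mass_esL lo K hloK P hP s, sHub_mass_esL lo K hloK P hP (s + r), ← esL_perm hO s, ← esL_perm hO (s + r)]
  have hprod : 0 ≤ (P.map (fun γ => 1 - γ)).prod := by
    apply List.prod_nonneg
    intro x hx
    rw [List.mem_map] at hx
    obtain ⟨γ, hγ, rfl⟩ := hx
    linarith [(hP γ hγ).2]
  have hOpos : ∀ x ∈ O, 0 ≤ x := by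
    intro x hx
    rw [hO.mem_iff, List.mem_map] at hx
    obtain ⟨γ, hγ, rfl⟩ := hx
    exact div_nonneg (hP γ hγ).1 (by linarith [(hP γ hγ).2])
  have hOlen : O.length = (P.length - s) + s := by rw [hO.length_eq, List.length_map]; omega
  have key := esL_choose_bound O hOs hOpos s r (P.length - s) hOlen
  calc (P.map (fun γ => 1 - γ)).prod * esL O s * esL (O.take (P.length - s)) r
      = (P.map (fun γ => 1 - γ)).prod * (esL O s * esL (O.take (P.length - s)) r) := by ring
    _ ≤ (P.map (fun γ => 1 - γ)).prod * (((s + r).choose s : ℝ) * esL O (s + r)) := mul_le_mul_of_nonneg_left key hprod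
    _ = ((s + r).choose s : ℝ) * ((P.map (fun γ => 1 - γ)).prod * esL O (s + r)) := by ring

end LawDec
end Quant
end Summit.CriticalPhenomena.PercolationContinuityZ3.Theorems
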